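import Literature.MathematicalPhysics.QuantumFieldTheory.Balaban1983to89.B13OpsYPencilRProjSym
import Literature.MathematicalPhysics.QuantumFieldTheory.Balaban1983to89.B13GreenSymLettersOfReg335Located
import Literature.MathematicalPhysics.QuantumFieldTheory.Balaban1983to89.B13XinvSymLettersOfReg335Located

/-!
# `Balaban1983to89.B13OpsYPencilRProjSymLocated` — T. Bałaban, *Propagators for lattice gauge theories in a background field*, Commun. Math. Phys. **99** (1985)
# 389–434 [Balaban1985BackgroundPropagators], (3.19)–(3.21) pp. 393–394 (`Q′(U)`), (3.24)–(3.25) pp. 394–395 («R(U) = I − G′(U)Q′*(U)(Q′(U)G′(U)²Q′*(U))⁻¹Q′(U)G′(U)»),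
# (3.35) p. 396, Thm 3.1 (3.42) p. 397, Thm 3.2 (3.48) p. 398, Thm 3.4 p. 400, Sect. B (3.66)–(3.68) p. 403, (3.69)–(3.70) p. 404, (3.71)–(3.72) p. 405, Thm 3.10 (3.107)–(3.108) p. 416; *Renormalization group approach to
# lattice gauge field theories. II*, Commun. Math. Phys. **116** (1988) 1–22 [Balaban1988RG2Cluster] (2.5)–(2.7) pp. 12–13, p. 15:
# ★★★ THE R-STATION ON THE (3.35) CLASS LOCATED — dag-n10-w2 g3's `B13OpsYPencilRProjSym` §2 with EVERY NODE-00 dictionary numeral a NUMBER at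
# `(M_N(ℂ), matrix units, fineReadingY ∕ blkReadingY)`.

statement-level composition of cited tree theorems; kernel-checked; THEOREMS ONLY; nothing of NODE 00's ∕ N06's ∕ the lane's files is modified; nothing here is a claim
about the Yang–Mills mass gap; no node is discharged; count-neutral.

WHY THIS FILE (cell `pub-ymgap`, HUMAN RULING D-0062 ∕ D-0149, Track A node N10 = [B13]; width seat `pub-ymgap-dag-n10-w2` g4; the lane's word INBOX l.35466 «LOCATED-NUMERALS
EDITIONS OF THE v4 INVERSE ROAD» and dag-n10-w4 g5's located census of the road's stations l.35500: G′ at the fine ∕ block reading = dag-n10-w6's `B13SiteReadingNumerals` §4,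
X⁻¹ = dag-n10-w5's located edition, the local part ∕ the G-station ∕ the G chain = dag-n10-w4 g5's `B13DeltaAPencilLettersLocated` ∕ `B13GreenStationLocated` ∕
`B13GreenSymLettersOfReg335Located`; the R-station was the one station of the road with no located edition).  The R-station on (3.35)
(`B13OpsYPencilRProjSym.rawEntryLetters_toMatrix_RY_parSymY_prodCfg_of_reg335_record`) displays NODE 00's dictionary numerals — 79's averaging support `D`, `Cavg`, the site
reading `ℓ′` with `s`, `κ`, fibre bound `m`, the `Q′`-support numeral `D_Q`, the kernel row ∕ column sums `CQsr`, `CQc`, the block reading `ℓB` with range `r` — as binders.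
THIS FILE writes them as numbers at the located readings now in the tree: `ℓ′ := fineReadingY i hNf` (dag-n10-w6 p611691: `D = 2(d+1)(L^k − 1)`, `Cavg = 1`, `s = (d+1)L^k`,
`κ = 1∕((d+1)L^k)`, `m = N²`), `ℓB := blkReadingY i hNf` (dag-n10-w4 p612491: `r = (d+1)(L^k − 1)`), `D_Q = (d+1)(L^k − 1)`, `CQsr = CQc = 1` (dag-n10-w4 p622736 §1), all BY NAME.
* §1 ★★★ `rawEntryLetters_toMatrix_RY_parSymY_prodCfg_of_reg335_located` — for EVERY `U₀ ∈ (bg9K (M_N ℂ) G i).Reg335 c α₀`: the matrix-unit coordinates of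
  `R(e^{iηA′}U₀)` have the N10 letters `RawEntryLetters (A′ ↦ toMatrix (R(e^{iηA′}U₀))) (fineReadingY ∘ fst) R′ (ρ_X − 2μ) B_R` with `B_R` a NUMBER in
  `(d, L^k, N, η, R′, B_X, ρ_X, μ)`.  DISPLAYED ONLY: the (3.35) data (`hG hC0 hC1 hreg`), the period vector `hNf`, `η`, the thin radius `0 < Rc`, the rate `0 ≤ ρ′ < δ₀∕((d+1)L^k)`,
  a radius `0 < R′ ≤ R₁⋆` (79's thin radius with the numbers written in — dag-n10-w6's ∕ dag-n10-w4's expression verbatim), the X⁻¹-junction's output `hXi` at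
  `(blkReadingY, R′, ρ_X, B_X)` with `0 ≤ ρ_X ≤ ρ′` (Theorem 3.2's content — dag-n10-w5's `B13XinvSymLettersOfReg335(Located)` supplies it on (3.35)), and the station's rate loss
  `0 < μ`, `2μ ≤ ρ_X`.
v1.1 (APPEND-ONLY; §1 byte-identical; import of dag-n10-w5's `B13XinvSymLettersOfReg335Located` added): + §2 ★★★ `rawEntryLetters_toMatrix_RY_parSymY_prodCfg_of_reg335_located_of_xinvLocated`
  — §1 at the record's own periods (`hNf := i.hN`) with the X⁻¹ input FED BY NAME by dag-n10-w5's located Theorem-3.2 knit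
  `B13XinvSymLettersOfReg335Located.rawEntryLetters_toMatrix_XinvY_parSymY_prodCfg_of_reg335_located` (p623629): the R-station on (3.35) with NO X⁻¹ letter and NO dictionary
  numeral displayed — remaining: the (3.35) data, `η`, `0 < Rc`, the X⁻¹ knit's rate chain `(ρ′, μ_X, κ_X, one numeric smallness, ρ″)` and the station's loss `0 < μ`, `2μ ≤ ρ″`.
HONEST FRAMING: a LOCATED INSTANCE of a landed composition; finite-lattice numerals, NOT optimised, NOT print's `O(1)`; `hXi` DISPLAYED (Theorem 3.2 is NOT proved here); the
G′ input inside is N06's tree theorem (Theorem 3.1 on (3.35), via module 79) — n06-w1's declared scope (one finite lattice operator at fixed `k`, single-scale rate `δ₀∕L^k` per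
step) carries over; print's multi-scale `δ₀d(y,y′)` NOT claimed; WHICH reading the N10 term of record uses is NODE 00's ∕ def-T's word (census v18 item 2); nothing of
Bałaban's asserted beyond the cited theorems; N06 ∕ N10 NOT discharged; K1⁸ NOT claimed; counts unmoved (typed 28∕28 · discharged 5∕27); 0 `def`, 0 `sorry`, standard
axioms; one finite 𝕋⁴ programme at fixed ε — R4 closes the conditional finite-𝕋⁴ rung `BalabanLadder.UV` only; the YM mass gap (Clay) is NOT proved by any of this; nothing
continuum ∕ ℝ⁴ ∕ OS.

References: T. Bałaban, CMP 99 (1985) 389–434 [Balaban1985BackgroundPropagators] (3.19)–(3.25) pp.393–395, (3.35) p.396, Thm 3.1 (3.42) p.397, Thm 3.2 (3.48) p.398, Thm 3.4 p.400,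
(3.60)–(3.65) p.402, (3.66)–(3.68) p.403, (3.69)–(3.70) p.404, (3.71)–(3.72) p.405, Thm 3.10 (3.107)–(3.108) p.416; CMP 96 (1984) 223–250 [Balaban1984PropagatorsII] (2.14)–(2.17) p.225, (2.45)–(2.46) p.231, Lemma 2.1 (2.61) p.234;
CMP 116 (1988) 1–22 [Balaban1988RG2Cluster] (2.5)–(2.7) pp.12–13, p.15.
DOC-ONLY EDITION (dag-n10-w2 g4, 2026-08-28): [B9] page locators corrected per the page owner lit-balaban-r06 — (3.25) p.394; (3.48) p.398; (3.60)–(3.65) p.402,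
(3.66)–(3.68) p.403, (3.69)–(3.70) p.404, (3.71)–(3.72) p.405; (3.84)–(3.86) p.407 only; every declaration byte-identical to the previous edition.
-/

noncomputable section

namespace Literature.MathematicalPhysics.QuantumFieldTheory.Balaban1983to89.B13OpsYPencilRProjSymLocated

open Finset Module
open scoped Matrix Matrix.Norms.L2Operator
open Literature.MathematicalPhysics.QuantumFieldTheory.Balaban1983to89
open Literature.MathematicalPhysics.QuantumFieldTheory.Balaban1983to89.B9Thm37GlueTorus (tdist1)
open Literature.MathematicalPhysics.QuantumFieldTheory.Balaban1983to89.B5TorusCover (UT)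
open Literature.MathematicalPhysics.QuantumFieldTheory.Balaban1983to89.B4TorusKernel.MultiPeriod (torusSupNorm)
open Literature.MathematicalPhysics.QuantumFieldTheory.Balaban1983to89.B13EntrywiseWalks (RawEntryLetters)
open Literature.MathematicalPhysics.QuantumFieldTheory.Balaban1983to89.B9Eq39Adjoint (prodCfg)
open Literature.MathematicalPhysics.QuantumFieldTheory.Balaban1983to89.B6GlobalChartV1 (PV boxEquiv)
open Literature.MathematicalPhysics.QuantumFieldTheory.Balaban1983to89.B6KLevelCensusIndexV1 (KIdx kGeo)
open Literature.MathematicalPhysics.QuantumFieldTheory.Balaban1983to89.B9BackgroundsKLevelV1 (bg9K)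
open Literature.MathematicalPhysics.QuantumFieldTheory.Balaban1983to89.Node00
  (SiteY BlkY CfgY toKT parSymY GpY XinvY RY)
open Literature.MathematicalPhysics.QuantumFieldTheory.Balaban1983to89.B9Thm37CubeCoverCommutatorSizes (sum_abs_avgCoeffY_le_one)
open Literature.MathematicalPhysics.QuantumFieldTheory.Balaban1983to89.B13OpsYPencilRProjSym (rawEntryLetters_toMatrix_RY_parSymY_prodCfg_of_reg335_record)
open Literature.MathematicalPhysics.QuantumFieldTheory.Balaban1983to89.B13SiteReadingNumerals
  (fineReadingY hD_avgCoeffY hℓ_fineReadingY hℓa_fineReadingY hκ_fineReadingY hfib_fineReadingY_matrixUnits)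
open Literature.MathematicalPhysics.QuantumFieldTheory.Balaban1983to89.B13BlockBondReadingNumerals (blkReadingY hℓQ_blkReadingY hℓQs_blkReadingY)
open Literature.MathematicalPhysics.QuantumFieldTheory.Balaban1983to89.B13GreenSymLettersOfReg335Located
  (hDQ_blkCornerY hDQs_blkCornerY sum_abs_qpsK_le_one sum_abs_qpK_col_le_one)
open Literature.MathematicalPhysics.QuantumFieldTheory.Balaban1983to89.B13XinvSymLettersOfReg335Located
  (rawEntryLetters_toMatrix_XinvY_parSymY_prodCfg_of_reg335_located)

variable {d ℓ : ℕ} {hd : 1 ≤ d + 1} {hL : Odd (ℓ + 1) ∧ 1 < ℓ + 1} {b₀ b₁ : ℝ}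
variable (i : KIdx d ℓ hd hL b₀ b₁)

/-! ## §1. ★★★ The R-station on the (3.35) class LOCATED at `(M_N(ℂ), matrix units, fineReadingY ∕ blkReadingY)` -/

section Located

variable {N : ℕ} [NeZero N] {G : Subgroup (Matrix (Fin N) (Fin N) ℂ)ˣ}
variable {Nf : Fin (d + 1) → ℕ} [∀ μ, NeZero (Nf μ)]

/-- ★★★ **THE R-STATION ON (3.35), EVERY NODE-00 NUMERAL A NUMBER.**  For EVERY background `U₀ ∈ (bg9K (M_N ℂ) G i).Reg335 c α₀` (`G ≤ U(N)`, `0 ≤ c·M·α₀`,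
`c·M·α₀·(d+1) ≤ 1∕16`), at the v4 letters of record (`parSymY`, `G′ = GpY i (parSymY i)`), matrix-unit coordinates, sites read by `fineReadingY`, blocks by `blkReadingY`:
dag-n10-w2 g3's `rawEntryLetters_toMatrix_RY_parSymY_prodCfg_of_reg335_record` with `D = 2(d+1)(L^k − 1)`, `Cavg = 1`, `s = (d+1)L^k`, `κ = 1∕((d+1)L^k)`, `m = N²`, `ν = d+1`,
`D_Q = (d+1)(L^k − 1)`, `CQsr = CQc = 1`, `r = (d+1)(L^k − 1)` substituted (dag-n10-w6 p611691, dag-n10-w4 p612491 ∕ p622736, `sum_abs_avgCoeffY_le_one` BY NAME).  DISPLAYED ONLY: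
the (3.35) data, `hNf`, `η`, `0 < Rc`, the rate `0 ≤ ρ′ < δ₀∕((d+1)L^k)` (`δ₀ = 1∕(4(d+2))`), a radius `0 < R′ ≤ R₁⋆` (79's thin radius with the numbers written in), the
X⁻¹-junction's output `hXi` at `(blkReadingY, R′, ρ_X, B_X)` with `0 ≤ ρ_X ≤ ρ′`, the rate loss `0 < μ`, `2μ ≤ ρ_X`.  Conclusion: `RawEntryLetters (A′ ↦ toMatrix (R(e^{iηA′}U₀)))
(fineReadingY ∘ fst) R′ (ρ_X − 2μ) (1 + B_G′·(B_N·B_G′·M)·M)` with `B_G′ = 2·16(L^k)²√N`, `B_N = (N²·e^{2|η|R′D_Q})²·B_X·e^{2ρ_X r}`, `M = N²·c₀(1,μ)^{d+1}` — numbers.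
[cite: Balaban1985BackgroundPropagators, (3.19)–(3.21) pp.393–394, (3.24)–(3.25) pp.394–395, (3.35) p.396, Thm 3.1 (3.42) p.397, Thm 3.2 (3.48) p.398, Thm 3.4 p.400,
(3.60)–(3.65) p.402, (3.66)–(3.68) p.403, (3.69)–(3.70) p.404, (3.71)–(3.72) p.405, Thm 3.10 (3.107)–(3.108) p.416; Balaban1984PropagatorsII, (2.14)–(2.17) p.225, (2.45)–(2.46) p.231, Lemma 2.1 (2.61) p.234;
Balaban1988RG2Cluster, (2.5)–(2.7) pp.12–13, p.15] -/
theorem rawEntryLetters_toMatrix_RY_parSymY_prodCfg_of_reg335_located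
    (hG : G ≤ B7Prop2Explicit.unitaryUnits (Matrix (Fin N) (Fin N) ℂ))
    {U₀ : CfgY (Matrix (Fin N) (Fin N) ℂ) i} {c α₀ : ℝ} (hC0 : 0 ≤ c * (kGeo i).M * α₀) (hC1 : c * (kGeo i).M * α₀ * ((d : ℝ) + 1) ≤ 1 / 16)
    (hreg : (bg9K (Matrix (Fin N) (Fin N) ℂ) G i).Reg335 c α₀ U₀)
    (hNf : ∀ μ, (toKT i).NB μ = Nf μ) (η : ℝ) {Rc : ℝ} (hRc : 0 < Rc)
    {ρ' : ℝ} (hρ'0 : 0 ≤ ρ') (hρ' : ρ' < (1 / (4 * ((d : ℝ) + 2))) * (((d : ℝ) + 1) * ((((ℓ + 1) ^ i.k : ℕ) : ℝ)))⁻¹)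
    -- the radius at which the R-station is read: any `0 < R′ ≤ R₁⋆` (79's located thin radius AT THE FINE READING, numbers written in)
    {R' : ℝ} (hR'0 : 0 < R')
    (hR' : R' ≤ Rc / (4 * ((1 * (((d : ℝ) + 1) *
          (1 * Real.exp (|η| * Rc) * (1 * Real.exp (|η| * Rc) * 1 * (1 * Real.exp (|η| * Rc)) + 1) * (1 * Real.exp (|η| * Rc)) +
            (1 * Real.exp (|η| * Rc) * 1 * (1 * Real.exp (|η| * Rc)) + 1)) +
          1 * ((1 * Real.exp (|η| * Rc)) ^ (2 * (d + 1) * ((ℓ + 1) ^ i.k - 1)) * 1 * (1 * Real.exp (|η| * Rc)) ^ (2 * (d + 1) * ((ℓ + 1) ^ i.k - 1)))) * Real.exp ((1 / (4 * ((d : ℝ) + 2)) * ((((d : ℝ) + 1) * ((((ℓ + 1) ^ i.k : ℕ) : ℝ)))⁻¹)) * (((d : ℝ) + 1) * ((((ℓ + 1) ^ i.k : ℕ) : ℝ))))) *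
          (1 * 1 * (16 * ((((ℓ + 1) ^ i.k : ℕ) : ℝ)) ^ 2 * Real.sqrt N)) *
          (((N * N : ℕ) : ℝ) * B6.c0 1 (((1 / (4 * ((d : ℝ) + 2))) * ((((d : ℝ) + 1) * ((((ℓ + 1) ^ i.k : ℕ) : ℝ)))⁻¹) - ρ') / 3) ^ (d + 1)) * (((N * N : ℕ) : ℝ) * B6.c0 1 (((1 / (4 * ((d : ℝ) + 2))) * ((((d : ℝ) + 1) * ((((ℓ + 1) ^ i.k : ℕ) : ℝ)))⁻¹) - ρ') / 3) ^ (d + 1))) + 1))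
    -- the X⁻¹-junction's output at `(blkReadingY, R′, ρ_X, B_X)`, `0 ≤ ρ_X ≤ ρ′` (Thm 3.2's content; displayed), and the station's rate loss `μ`
    {ρX BX μ : ℝ} (hρX0 : 0 ≤ ρX) (hρX : ρX ≤ ρ')
    (hXi : RawEntryLetters (fun a : Fin (d + 1) → Site (PV d ℓ i.m i.K hd hL) 0 → Matrix (Fin N) (Fin N) ℂ =>
      LinearMap.toMatrix
        ((Pi.basis fun _ : BlkY i => Matrix.stdBasis ℂ (Fin N) (Fin N)).reindex (Equiv.sigmaEquivProd (BlkY i) (Fin N × Fin N)))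
        ((Pi.basis fun _ : BlkY i => Matrix.stdBasis ℂ (Fin N) (Fin N)).reindex (Equiv.sigmaEquivProd (BlkY i) (Fin N × Fin N)))
        (XinvY i (parSymY i) (GpY i (parSymY i)) (prodCfg U₀ η a)))
      (fun p : BlkY i × (Fin N × Fin N) => blkReadingY i hNf p.1) R' ρX BX)
    (hμ : 0 < μ) (h2μ : 2 * μ ≤ ρX) :
    RawEntryLetters (fun a : Fin (d + 1) → Site (PV d ℓ i.m i.K hd hL) 0 → Matrix (Fin N) (Fin N) ℂ =>
        LinearMap.toMatrix
          ((Pi.basis fun _ : SiteY i => Matrix.stdBasis ℂ (Fin N) (Fin N)).reindex (Equiv.sigmaEquivProd (SiteY i) (Fin N × Fin N)))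
          ((Pi.basis fun _ : SiteY i => Matrix.stdBasis ℂ (Fin N) (Fin N)).reindex (Equiv.sigmaEquivProd (SiteY i) (Fin N × Fin N)))
          (RY i (parSymY i) (GpY i (parSymY i)) (prodCfg U₀ η a)))
      (fun q : SiteY i × (Fin N × Fin N) => fineReadingY i hNf q.1) R' (ρX - 2 * μ)
      (1 + 2 * (1 * 1 * (16 * ((((ℓ + 1) ^ i.k : ℕ) : ℝ)) ^ 2 * Real.sqrt N)) *
          (1 * (Fintype.card (Fin N × Fin N) : ℝ) *
              (1 * ((1 * Real.exp (|η| * R')) ^ ((d + 1) * ((ℓ + 1) ^ i.k - 1)) * 1 * (1 * Real.exp (|η| * R')) ^ ((d + 1) * ((ℓ + 1) ^ i.k - 1)))) *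
            (1 * (Fintype.card (Fin N × Fin N) : ℝ) *
              (1 * ((1 * Real.exp (|η| * R')) ^ ((d + 1) * ((ℓ + 1) ^ i.k - 1)) * 1 * (1 * Real.exp (|η| * R')) ^ ((d + 1) * ((ℓ + 1) ^ i.k - 1))))) * BX *
            Real.exp (2 * ρX * (((d : ℝ) + 1) * ((((ℓ + 1) ^ i.k : ℕ) : ℝ) - 1))) * (2 * (1 * 1 * (16 * ((((ℓ + 1) ^ i.k : ℕ) : ℝ)) ^ 2 * Real.sqrt N))) *
            (((N * N : ℕ) : ℝ) * B6.c0 1 μ ^ (d + 1))) *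
          (((N * N : ℕ) : ℝ) * B6.c0 1 μ ^ (d + 1))) :=
  rawEntryLetters_toMatrix_RY_parSymY_prodCfg_of_reg335_record i hG hC0 hC1 hreg η hRc (hD_avgCoeffY i) zero_le_one (sum_abs_avgCoeffY_le_one i)
    (fineReadingY i hNf) (by positivity) (hℓ_fineReadingY i hNf) (hℓa_fineReadingY i hNf) (by positivity) (hκ_fineReadingY i hNf)
    (hfib_fineReadingY_matrixUnits i hNf) hρ'0 hρ' hR'0 hR' (hDQ_blkCornerY i) (hDQs_blkCornerY i) zero_le_one (sum_abs_qpsK_le_one i) zero_le_one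
    (sum_abs_qpK_col_le_one i) (blkReadingY i hNf) (hℓQ_blkReadingY i hNf) (hℓQs_blkReadingY i hNf) hρX0 hρX hXi hμ h2μ

end Located

/-! ## §2. ★★★ (v1.1) The located R-station FED by dag-n10-w5's located X⁻¹ knit: no X⁻¹ letter displayed -/

section Fed

variable {N : ℕ} [NeZero N] {G : Subgroup (Matrix (Fin N) (Fin N) ℂ)ˣ}

/-- ★★★ **THE R-STATION ON (3.35) AT THE RECORD's READINGS, X⁻¹ SUPPLIED BY NAME — NO X⁻¹ LETTER, NO DICTIONARY NUMERAL DISPLAYED.**  For EVERY background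
`U₀ ∈ (bg9K (M_N ℂ) G i).Reg335 c α₀` (`G ≤ U(N)`, `0 ≤ c·M·α₀`, `c·M·α₀·(d+1) ≤ 1∕16`): §1 at `hNf := i.hN` with `hXi` := dag-n10-w5's
`B13XinvSymLettersOfReg335Located.rawEntryLetters_toMatrix_XinvY_parSymY_prodCfg_of_reg335_located` (Theorem 3.2's content on (3.35) through `B13XinvCentreDecayOfReg335` ∕ 81 ∕ 79 —
N06's Theorem 3.1 and the invertibility of `Δ′_a` inside, NO N06 binder), its `∃ R₁ ≤ R⋆` opened: the radius `R₁` IS the station's `R′`, the X⁻¹ rate `ρ″ < κ_X ≤ (ρ′ − μ_X)∕4 ≤ ρ′`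
IS the station's `ρ_X`.  DISPLAYED ONLY: the (3.35) data, `η`, the thin radius `0 < Rc`, the X⁻¹ knit's rate chain — `0 ≤ ρ′ < δ₀∕((d+1)L^k)`, `0 < μ_X < ρ′`, `0 ≤ κ_X ≤ (ρ′ − μ_X)∕4`,
its ONE numeric smallness `hκm`, `0 ≤ ρ″ < κ_X` — and the station's loss `0 < μ`, `2μ ≤ ρ″`.  Conclusion: `∃ R₁, 0 < R₁ ∧ R₁ ≤ R⋆ ∧ RawEntryLetters (A′ ↦ toMatrix (R(e^{iηA′}U₀)))
(fineReadingY i i.hN ∘ fst) R₁ (ρ″ − 2μ) B_R(R₁)` with `B_R` §1's number at `B_X = 2·N³·√((L^k)^{d+1})·(4∕(4(d+1)+1)²)⁻¹`.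
[cite: Balaban1985BackgroundPropagators, (3.19)–(3.21) pp.393–394, (3.24)–(3.25) pp.394–395, (3.35) p.396, Thm 3.1 (3.42) p.397, Thm 3.2 (3.48) p.398, Thm 3.4 p.400,
(3.60)–(3.65) p.402, (3.66)–(3.68) p.403, (3.69)–(3.70) p.404, (3.71)–(3.72) p.405, Thm 3.10 (3.107)–(3.108) p.416; Balaban1984PropagatorsII, (2.14)–(2.17) p.225, Lemma 2.1 (2.61) p.234; Balaban1988RG2Cluster, (2.5)–(2.7) pp.12–13, p.15] -/
theorem rawEntryLetters_toMatrix_RY_parSymY_prodCfg_of_reg335_located_of_xinvLocated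
    (hG : G ≤ B7Prop2Explicit.unitaryUnits (Matrix (Fin N) (Fin N) ℂ))
    {U₀ : CfgY (Matrix (Fin N) (Fin N) ℂ) i} {c α₀ : ℝ} (hC0 : 0 ≤ c * (kGeo i).M * α₀) (hC1 : c * (kGeo i).M * α₀ * ((d : ℝ) + 1) ≤ 1 / 16)
    (hreg : (bg9K (Matrix (Fin N) (Fin N) ℂ) G i).Reg335 c α₀ U₀)
    (η : ℝ) {Rc : ℝ} (hRc : 0 < Rc) {ρ' : ℝ} (hρ'0 : 0 ≤ ρ')
    (hρ' : ρ' < (1 / (4 * ((d : ℝ) + 2))) * ((((d : ℝ) + 1) * ((((ℓ + 1) ^ i.k : ℕ) : ℝ)))⁻¹))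
    -- the X⁻¹ knit's loss `μ_X`, rate `κ_X` with its one numeric smallness, and its output rate `ρ″` (dag-n10-w5's hypotheses verbatim)
    {μX : ℝ} (hμX : 0 < μX) (hμρ : μX < ρ')
    {κX : ℝ} (hκX : 0 ≤ κX) (hκ4 : κX ≤ (ρ' - μX) / 4)
    (hκm : 8 * (Real.sqrt ((((ℓ : ℝ) + 1) ^ i.k) ^ (d + 1)) *
        (1 * (Fintype.card (Fin N × Fin N) : ℝ) *
            (1 * ((1 * Real.exp (|η| * Rc)) ^ ((d + 1) * ((ℓ + 1) ^ i.k - 1)) * 1 * (1 * Real.exp (|η| * Rc)) ^ ((d + 1) * ((ℓ + 1) ^ i.k - 1)))) *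
          ((((ℓ : ℝ) + 1) ^ i.k) ^ (d + 1) * (Fintype.card (Fin N × Fin N) : ℝ) *
            (1 * ((1 * Real.exp (|η| * Rc)) ^ ((d + 1) * ((ℓ + 1) ^ i.k - 1)) * 1 * (1 * Real.exp (|η| * Rc)) ^ ((d + 1) * ((ℓ + 1) ^ i.k - 1))))) *
          ((2 * (1 * 1 * (16 * ((((ℓ + 1) ^ i.k : ℕ) : ℝ)) ^ 2 * Real.sqrt N))) * (2 * (1 * 1 * (16 * ((((ℓ + 1) ^ i.k : ℕ) : ℝ)) ^ 2 * Real.sqrt N))) *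
            (((N * N : ℕ) : ℝ) * B6.c0 1 μX ^ (d + 1))) *
          Real.exp (2 * (ρ' - μX) * (((d : ℝ) + 1) * (((((ℓ + 1) ^ i.k : ℕ) : ℝ)) - 1))))) * κX *
        (((N * N : ℕ) : ℝ) * B6.c0 1 ((ρ' - μX) / 2) ^ (d + 1)) ≤
      ((4 * ((d : ℝ) + 1) + 1) ^ 2)⁻¹ * (ρ' - μX))
    {ρ'' : ℝ} (hρ''0 : 0 ≤ ρ'') (hρ'' : ρ'' < κX)
    -- the station's own rate loss
    {μ : ℝ} (hμ : 0 < μ) (h2μ : 2 * μ ≤ ρ'') :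
    ∃ R₁ : ℝ, 0 < R₁ ∧
      R₁ ≤ Rc / (4 * ((1 * (((d : ℝ) + 1) *
          (1 * Real.exp (|η| * Rc) * (1 * Real.exp (|η| * Rc) * 1 * (1 * Real.exp (|η| * Rc)) + 1) * (1 * Real.exp (|η| * Rc)) +
            (1 * Real.exp (|η| * Rc) * 1 * (1 * Real.exp (|η| * Rc)) + 1)) +
          1 * ((1 * Real.exp (|η| * Rc)) ^ (2 * (d + 1) * ((ℓ + 1) ^ i.k - 1)) * 1 * (1 * Real.exp (|η| * Rc)) ^ (2 * (d + 1) * ((ℓ + 1) ^ i.k - 1)))) *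
            Real.exp ((1 / (4 * ((d : ℝ) + 2)) * ((((d : ℝ) + 1) * ((((ℓ + 1) ^ i.k : ℕ) : ℝ)))⁻¹)) * (((d : ℝ) + 1) * ((((ℓ + 1) ^ i.k : ℕ) : ℝ))))) *
          (1 * 1 * (16 * ((((ℓ + 1) ^ i.k : ℕ) : ℝ)) ^ 2 * Real.sqrt N)) *
          (((N * N : ℕ) : ℝ) * B6.c0 1 (((1 / (4 * ((d : ℝ) + 2))) * ((((d : ℝ) + 1) * ((((ℓ + 1) ^ i.k : ℕ) : ℝ)))⁻¹) - ρ') / 3) ^ (d + 1)) *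
          (((N * N : ℕ) : ℝ) * B6.c0 1 (((1 / (4 * ((d : ℝ) + 2))) * ((((d : ℝ) + 1) * ((((ℓ + 1) ^ i.k : ℕ) : ℝ)))⁻¹) - ρ') / 3) ^ (d + 1))) + 1) ∧
      RawEntryLetters (fun a : Fin (d + 1) → Site (PV d ℓ i.m i.K hd hL) 0 → Matrix (Fin N) (Fin N) ℂ =>
          LinearMap.toMatrix
            ((Pi.basis fun _ : SiteY i => Matrix.stdBasis ℂ (Fin N) (Fin N)).reindex (Equiv.sigmaEquivProd (SiteY i) (Fin N × Fin N)))
            ((Pi.basis fun _ : SiteY i => Matrix.stdBasis ℂ (Fin N) (Fin N)).reindex (Equiv.sigmaEquivProd (SiteY i) (Fin N × Fin N)))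
            (RY i (parSymY i) (GpY i (parSymY i)) (prodCfg U₀ η a)))
        (fun q : SiteY i × (Fin N × Fin N) => fineReadingY i i.hN q.1) R₁ (ρ'' - 2 * μ)
        (1 + 2 * (1 * 1 * (16 * ((((ℓ + 1) ^ i.k : ℕ) : ℝ)) ^ 2 * Real.sqrt N)) *
            (1 * (Fintype.card (Fin N × Fin N) : ℝ) *
                (1 * ((1 * Real.exp (|η| * R₁)) ^ ((d + 1) * ((ℓ + 1) ^ i.k - 1)) * 1 * (1 * Real.exp (|η| * R₁)) ^ ((d + 1) * ((ℓ + 1) ^ i.k - 1)))) *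
              (1 * (Fintype.card (Fin N × Fin N) : ℝ) *
                (1 * ((1 * Real.exp (|η| * R₁)) ^ ((d + 1) * ((ℓ + 1) ^ i.k - 1)) * 1 * (1 * Real.exp (|η| * R₁)) ^ ((d + 1) * ((ℓ + 1) ^ i.k - 1))))) *
              (2 * (1 * 1 * ((N : ℝ) ^ 3 * (Real.sqrt ((((ℓ : ℝ) + 1) ^ i.k) ^ (d + 1)) * (4 / ((4 * ((d : ℝ) + 1) + 1) ^ 2)⁻¹))))) *
              Real.exp (2 * ρ'' * (((d : ℝ) + 1) * ((((ℓ + 1) ^ i.k : ℕ) : ℝ) - 1))) * (2 * (1 * 1 * (16 * ((((ℓ + 1) ^ i.k : ℕ) : ℝ)) ^ 2 * Real.sqrt N))) *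
              (((N * N : ℕ) : ℝ) * B6.c0 1 μ ^ (d + 1))) *
            (((N * N : ℕ) : ℝ) * B6.c0 1 μ ^ (d + 1))) := by
  -- X⁻¹ along the pencil on (3.35) at the record's readings, BY NAME (dag-n10-w5), at some radius `0 < R₁ ≤ R⋆`
  obtain ⟨R₁, hR₁, hR₁le, hXi⟩ := rawEntryLetters_toMatrix_XinvY_parSymY_prodCfg_of_reg335_located i hG hC0 hC1 hreg η hRc hρ'0 hρ' hμX hμρ hκX hκ4 hκm hρ''0 hρ''
  -- the X⁻¹ rate lies below the G′ rate: `ρ″ < κ_X ≤ (ρ′ − μ_X)∕4 ≤ ρ′`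
  have hρX : ρ'' ≤ ρ' := by linarith only [hρ'', hκ4, hμX.le, hρ'0]
  exact ⟨R₁, hR₁, hR₁le, rawEntryLetters_toMatrix_RY_parSymY_prodCfg_of_reg335_located i hG hC0 hC1 hreg i.hN η hRc hρ'0 hρ' hR₁ hR₁le hρ''0 hρX hXi hμ h2μ⟩

end Fed

end Literature.MathematicalPhysics.QuantumFieldTheory.Balaban1983to89.B13OpsYPencilRProjSymLocated

end
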